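import Summits.QuantumFields.YangMills.Theorems.FluctuationComparisonRegPrIntLS2BetaStrataOfGaugedLetters
import Summits.QuantumFields.YangMills.Theorems.CovariantDischargeUniformFluxLetters
import Summits.QuantumFields.YangMills.Theorems.FluctuationComparisonRegPrIntLS2BetaSmallBondGaugeToronObstruction
import Literature.MathematicalPhysics.QuantumFieldTheory.Balaban1983to89.B12RTGaugeInvariance254
import HarnessLib

/-!
# S2β ∕ GAP♯∘ (D)-side — THE FLAT TORON LIES ON THE ABELIAN STRATUM `A′`: the `e₀`-toron of angle `a` with `sin(N·a) ≠ 0` satisfies the `hD₂`∕`hF₂` guard of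
# ✓`…S2BetaStrataOfGaugedLetters.uniformFibreGapOrbit_of_gaugedLetters` (bonds `σ₃`-commuting in the trivial gauge; every covariantly constant matrix field is CONSTANT and
# `σ₃`-commuting) — the membership input of ✓`…S2BetaSmallBondGaugeToronObstruction.not_hsupp_of_unreachable` ∕ `not_hsupp_smallBond_of_mem` on that stratum

Cell `ym3-torus` (YM ladder rung R3 = continuum `SU(2)` Yang–Mills on the three-torus — a RUNG: NOT d = 4, NOT infinite volume, NOT a mass gap, NOT Clay).
Width seat «width 8» `ym3-torus-px8` (gen 24), FREE px helper on crux `stmt-QuantumFields-20520`, count-neutral, DEFINITION-FREE, default heartbeats.  Elementary `2×2` algebra on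
the torus lattice; nothing of Bałaban's asserted.

WHAT.  §1 the toron's bond matrices (`diag(e^{ia}, e^{−ia})` and `1`) commute with `σ₃`; §2 covariantly constant matrix fields: transport along the other directions is the
identity, along `e_{μ₀}` it is conjugation by `t`; around the `μ₀`-cycle the field commutes with `t^N = diag(e^{iNa}, e^{−iNa})`, hence is DIAGONAL when `sin(Na) ≠ 0`, hence
shift-invariant in every direction, hence CONSTANT (a shift-invariant function on `(ℤ∕N)^d` is constant); §3 ★★ `toron_mem_abelianStratum` — the `hD₂` guard VERBATIM at the toron.
HONEST: a membership computation; (D♮)∕(F♮)∕GAP♯∘, S2β, the five registered stubs, 20520, `YM3TorusSU2` NOT proved; rung R3 — NOT d = 4, NOT infinite volume, NOT a mass gap,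
NOT Clay.  Sorry-free, axioms standard.
-/

set_option autoImplicit false

noncomputable section

namespace Summit.QuantumFields.YangMills.Theorems.FluctuationComparisonRegPrIntLS2BetaSmallBondGaugeToronAbelianStratum

open scoped Real
open Literature.MathematicalPhysics.QuantumLattice (su2Quat quatMatrix quatMatrix_su2Quat quatMatrix_apply_00 quatMatrix_apply_01 quatMatrix_apply_10 quatMatrix_apply_11)
open Literature.MathematicalPhysics.QuantumFieldTheory.Balaban1983to89
open T4CubeChartGnomonic (SU2)
open T4HaarSU2ExpChart (expPoint)
open B9AdOrthogonal (σ₃)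
open B10Eq27TorusAxialLog (unitsField toUField)
open B12RTGaugeInvariance254 (gaugeAct_one')
open Summit.QuantumFields.YangMills.Theorems.CovariantDischargeUniformFluxLetters (su2Quat_expPoint_e0)
open Summit.QuantumFields.YangMills.Theorems.FluctuationComparisonRegPrIntLS2BetaSmallBondGaugeToronObstruction (expPoint_smul_pow sitesPerDir_run_zero not_hsupp_smallBond_of_mem)
open T4ExpWindowSmallField (logVec)
open T3ContinuumYM3Torus (T3Family)
open T3UnitScaleTilt (θBal)

variable {P : Params} {j : ℕ}

/-! ## §1 The toron's bond matrices commute with `σ₃` -/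

/-- The matrix of `exp(θ·e₀)` is `diag(cos θ + i sin θ, cos θ − i sin θ)`. [folklore] -/
theorem coe_expPoint_e0 (θ : ℝ) :
    ((expPoint (θ • EuclideanSpace.single (0 : Fin 3) (1 : ℝ)) : SU2) : Matrix (Fin 2) (Fin 2) ℂ) =
      !![(⟨Real.cos θ, Real.sin θ⟩ : ℂ), 0; 0, ⟨Real.cos θ, -Real.sin θ⟩] := by
  rw [← quatMatrix_su2Quat, su2Quat_expPoint_e0]
  ext i j
  fin_cases i <;> fin_cases j <;> simp [quatMatrix_apply_00, quatMatrix_apply_01, quatMatrix_apply_10, quatMatrix_apply_11] <;> rfl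

/-- A diagonal `2×2` matrix commutes with `σ₃`. [folklore] -/
theorem commute_diag_σ₃ (z w : ℂ) : Commute (!![z, 0; 0, w] : Matrix (Fin 2) (Fin 2) ℂ) σ₃ := by
  unfold Commute SemiconjBy σ₃
  simp

/-- The toron's `μ₀`-bonds `exp(a·e₀)` commute with `σ₃`. [folklore] -/
theorem commute_expPoint_e0_σ₃ (a : ℝ) :
    Commute (((expPoint (a • EuclideanSpace.single (0 : Fin 3) (1 : ℝ)) : SU2) : Matrix (Fin 2) (Fin 2) ℂ)) σ₃ := by
  rw [coe_expPoint_e0]; exact commute_diag_σ₃ _ _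

/-- Every bond of the toron commutes with `σ₃`. [folklore] -/
theorem commute_toron_bond_σ₃ (a : ℝ) (μ₀ : Fin P.d) (e : PBond P j) :
    Commute (((fun b : PBond P j => if b.dir = μ₀ then expPoint (a • EuclideanSpace.single (0 : Fin 3) (1 : ℝ)) else (1 : SU2)) e : SU2) :
      Matrix (Fin 2) (Fin 2) ℂ) σ₃ := by
  by_cases h : e.dir = μ₀
  · simp only [h, if_true]; exact commute_expPoint_e0_σ₃ a
  · simp only [h, if_false]; exact Commute.one_left _

/-! ## §2 Covariantly constant matrix fields over a diagonal toron are constant and diagonal -/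

/-- A function on the torus sites that is invariant under every unit shift is constant. [folklore] -/
theorem eq_of_forall_shift_eq {α : Type*} (c : Site P j → α) (h : ∀ (x : Site P j) (μ : Fin P.d), c (x.shift μ) = c x) (x y : Site P j) :
    c x = c y := by
  -- invariance under `k` shifts in direction `μ`
  have h1 : ∀ (μ : Fin P.d) (k : ℕ) (x : Site P j), c (Function.update x μ (x μ + (k : ZMod (P.sitesPerDir j)))) = c x := by
    intro μ k
    induction k with
    | zero => intro x; rw [Nat.cast_zero, add_zero, Function.update_eq_self]
    | succ k ih =>
        intro x
        have hs : Function.update x μ (x μ + ((k + 1 : ℕ) : ZMod (P.sitesPerDir j))) =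
            Site.shift (P := P) (j := j) (Function.update x μ (x μ + (k : ZMod (P.sitesPerDir j)))) μ := by
          unfold Site.shift
          rw [Function.update_idem, Function.update_self, Nat.cast_succ, add_assoc]
        rw [hs, h, ih]
  -- hence under resetting one coordinate
  have h2 : ∀ (μ : Fin P.d) (x : Site P j) (z : ZMod (P.sitesPerDir j)), c (Function.update x μ z) = c x := by
    intro μ x z
    have hz : z = x μ + (((z - x μ).val : ℕ) : ZMod (P.sitesPerDir j)) := by
      rw [ZMod.natCast_zmod_val]; ring
    rw [hz]; exact h1 μ _ x
  -- induction on the set of coordinates where `x` and `y` may differ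
  have h3 : ∀ (s : Finset (Fin P.d)) (x y : Site P j), (∀ μ, μ ∉ s → x μ = y μ) → c x = c y := by
    intro s
    induction s using Finset.induction_on with
    | empty => intro x y hxy; rw [show x = y from funext fun μ => hxy μ (Finset.notMem_empty μ)]
    | @insert μ s hμ ih =>
        intro x y hxy
        have hy' : c (Function.update y μ (x μ)) = c y := h2 μ y (x μ)
        rw [← hy']
        refine ih x _ fun ν hν => ?_
        by_cases hνμ : ν = μ
        · subst hνμ; rw [Function.update_self]
        · rw [Function.update_of_ne hνμ]; exact hxy ν (by simp [hνμ, hν])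
  exact h3 Finset.univ x y fun μ hμ => absurd (Finset.mem_univ μ) hμ

/-- **DIRECTION FIELDS.** For a field CONSTANT PER DIRECTION, `V b = f(b.dir)` (flat tori: every plaquette variable is the commutator `f μ f ν (f μ)⁻¹ (f ν)⁻¹`), a covariantly
constant matrix field `c` transports along direction `μ` by conjugation with `f μ`. [folklore] -/
theorem covConst_dirField_rel (f : Fin P.d → SU2) (c : Site P j → Matrix (Fin 2) (Fin 2) ℂ)
    (hc : ∀ e : PBond P j, c e.src =
      ((unitsField (toUField (fun b : PBond P j => f b.dir)) e : (Matrix (Fin 2) (Fin 2) ℂ)ˣ) : Matrix (Fin 2) (Fin 2) ℂ) * c e.tgt *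
      (((unitsField (toUField (fun b : PBond P j => f b.dir)) e)⁻¹ : (Matrix (Fin 2) (Fin 2) ℂ)ˣ) : Matrix (Fin 2) (Fin 2) ℂ))
    (x : Site P j) (μ : Fin P.d) :
    c x = (f μ : Matrix (Fin 2) (Fin 2) ℂ) * c (x.shift μ) * (((f μ)⁻¹ : SU2) : Matrix (Fin 2) (Fin 2) ℂ) :=
  hc ⟨x, μ⟩

/-- Products and powers in `SU(2)` read on the matrices. [folklore] -/
theorem coe_pow_su2 (g : SU2) : ∀ n : ℕ, ((g ^ n : SU2) : Matrix (Fin 2) (Fin 2) ℂ) = (g : Matrix (Fin 2) (Fin 2) ℂ) ^ n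
  | 0 => by rw [pow_zero, pow_zero]; rfl
  | n + 1 => by rw [pow_succ, pow_succ, ← coe_pow_su2 g n]; rfl

/-- Iterating the transport `k` times along the `μ`-line. [folklore] -/
theorem covConst_dirField_iter (g : SU2) (μ : Fin P.d) (c : Site P j → Matrix (Fin 2) (Fin 2) ℂ)
    (hlong : ∀ x : Site P j, c x = (g : Matrix (Fin 2) (Fin 2) ℂ) * c (x.shift μ) * ((g⁻¹ : SU2) : Matrix (Fin 2) (Fin 2) ℂ)) :
    ∀ (k : ℕ) (x : Site P j), c x = ((g ^ k : SU2) : Matrix (Fin 2) (Fin 2) ℂ) * c (Function.update x μ (x μ + (k : ZMod (P.sitesPerDir j)))) *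
      (((g⁻¹) ^ k : SU2) : Matrix (Fin 2) (Fin 2) ℂ)
  | 0, x => by
      rw [pow_zero, pow_zero, Nat.cast_zero, add_zero, Function.update_eq_self]
      show c x = 1 * c x * 1
      rw [one_mul, mul_one]
  | k + 1, x => by
      have hs : Function.update x μ (x μ + ((k + 1 : ℕ) : ZMod (P.sitesPerDir j))) =
          Site.shift (P := P) (j := j) (Function.update x μ (x μ + (k : ZMod (P.sitesPerDir j)))) μ := by
        unfold Site.shift
        rw [Function.update_idem, Function.update_self, Nat.cast_succ, add_assoc]
      rw [covConst_dirField_iter g μ c hlong k x, hlong (Function.update x μ (x μ + (k : ZMod (P.sitesPerDir j)))), ← hs,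
        coe_pow_su2, coe_pow_su2, coe_pow_su2, coe_pow_su2, pow_succ, pow_succ' ((g⁻¹ : SU2) : Matrix (Fin 2) (Fin 2) ℂ)]
      simp only [mul_assoc]

/-- Around the full `μ`-cycle: every value of the field commutes with `g^N`, `N = sitesPerDir` (the Polyakov holonomy of the direction field in direction `μ`). [folklore] -/
theorem covConst_dirField_commute_pow (g : SU2) (μ : Fin P.d) (c : Site P j → Matrix (Fin 2) (Fin 2) ℂ)
    (hlong : ∀ x : Site P j, c x = (g : Matrix (Fin 2) (Fin 2) ℂ) * c (x.shift μ) * ((g⁻¹ : SU2) : Matrix (Fin 2) (Fin 2) ℂ)) (x : Site P j) :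
    c x * ((g ^ P.sitesPerDir j : SU2) : Matrix (Fin 2) (Fin 2) ℂ) = ((g ^ P.sitesPerDir j : SU2) : Matrix (Fin 2) (Fin 2) ℂ) * c x := by
  have h := covConst_dirField_iter g μ c hlong (P.sitesPerDir j) x
  rw [ZMod.natCast_self, add_zero, Function.update_eq_self] at h
  have hinv : (((g⁻¹) ^ P.sitesPerDir j : SU2) : Matrix (Fin 2) (Fin 2) ℂ) * ((g ^ P.sitesPerDir j : SU2) : Matrix (Fin 2) (Fin 2) ℂ) = 1 := by
    rw [← Submonoid.coe_mul, inv_pow, inv_mul_cancel]; rfl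
  conv_lhs => rw [h]
  rw [mul_assoc, hinv, mul_one]

/-- A `2×2` matrix commuting with `diag(z, w)`, `z ≠ w`, is diagonal. [folklore] -/
theorem offDiag_eq_zero_of_commute_diag {z w : ℂ} (hzw : z ≠ w) (C : Matrix (Fin 2) (Fin 2) ℂ)
    (h : C * !![z, 0; 0, w] = !![z, 0; 0, w] * C) : C 0 1 = 0 ∧ C 1 0 = 0 := by
  have h01 := congrFun (congrFun h 0) 1
  have h10 := congrFun (congrFun h 1) 0
  simp [Matrix.mul_apply, Fin.sum_univ_two] at h01 h10
  constructor
  · have : C 0 1 * (w - z) = 0 := by linear_combination h01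
    exact (mul_eq_zero.1 this).resolve_right (sub_ne_zero.2 (Ne.symm hzw))
  · have : C 1 0 * (z - w) = 0 := by linear_combination h10
    exact (mul_eq_zero.1 this).resolve_right (sub_ne_zero.2 hzw)

/-- Conjugating a diagonal matrix by a diagonal group element does nothing. [folklore] -/
theorem diag_conj_eq (g : SU2) {z w : ℂ} (hg : (g : Matrix (Fin 2) (Fin 2) ℂ) = !![z, 0; 0, w]) (C : Matrix (Fin 2) (Fin 2) ℂ)
    (h01 : C 0 1 = 0) (h10 : C 1 0 = 0) :
    (g : Matrix (Fin 2) (Fin 2) ℂ) * C * ((g⁻¹ : SU2) : Matrix (Fin 2) (Fin 2) ℂ) = C := by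
  have hcomm : (g : Matrix (Fin 2) (Fin 2) ℂ) * C = C * (g : Matrix (Fin 2) (Fin 2) ℂ) := by
    rw [Matrix.eta_fin_two C, h01, h10, hg]
    simp [mul_comm]
  have hinv : (g : Matrix (Fin 2) (Fin 2) ℂ) * ((g⁻¹ : SU2) : Matrix (Fin 2) (Fin 2) ℂ) = 1 := by
    rw [← Submonoid.coe_mul, mul_inv_cancel]; rfl
  rw [hcomm, mul_assoc, hinv, mul_one]

/-- ★★ **COVARIANTLY CONSTANT FIELDS OVER A DIAGONAL DIRECTION FIELD WITH A RESONANCE-FREE DIRECTION ARE CONSTANT AND DIAGONAL**: if every `f μ` is diagonal and in SOME direction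
`μ₀` the Polyakov power `(f μ₀)^N = diag(z_N, w_N)` has `z_N ≠ w_N` (`N = sitesPerDir`), every matrix field transported by `b ↦ f(b.dir)` into itself is a constant `σ₃`-commuting
matrix. [folklore] -/
theorem covConst_dirField_const (f : Fin P.d → SU2) (z w : Fin P.d → ℂ) (hf : ∀ μ, (f μ : Matrix (Fin 2) (Fin 2) ℂ) = !![z μ, 0; 0, w μ])
    (μ₀ : Fin P.d) {zN wN : ℂ} (hN : ((f μ₀ ^ P.sitesPerDir j : SU2) : Matrix (Fin 2) (Fin 2) ℂ) = !![zN, 0; 0, wN]) (hzw : zN ≠ wN)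
    (c : Site P j → Matrix (Fin 2) (Fin 2) ℂ)
    (hc : ∀ e : PBond P j, c e.src =
      ((unitsField (toUField (fun b : PBond P j => f b.dir)) e : (Matrix (Fin 2) (Fin 2) ℂ)ˣ) : Matrix (Fin 2) (Fin 2) ℂ) * c e.tgt *
      (((unitsField (toUField (fun b : PBond P j => f b.dir)) e)⁻¹ : (Matrix (Fin 2) (Fin 2) ℂ)ˣ) : Matrix (Fin 2) (Fin 2) ℂ)) :
    ∃ c₀ : Matrix (Fin 2) (Fin 2) ℂ, (∀ y, c y = c₀) ∧ Commute c₀ σ₃ := by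
  have hrel := covConst_dirField_rel f c hc
  -- every value is diagonal (the `μ₀`-cycle)
  have hdiag : ∀ x, c x 0 1 = 0 ∧ c x 1 0 = 0 := fun x =>
    offDiag_eq_zero_of_commute_diag hzw (c x) (by rw [← hN]; exact covConst_dirField_commute_pow (f μ₀) μ₀ c (fun y => hrel y μ₀) x)
  -- hence invariant under every shift
  have hshift : ∀ (x : Site P j) (μ : Fin P.d), c (x.shift μ) = c x := fun x μ => by
    rw [hrel x μ, diag_conj_eq (f μ) (hf μ) _ (hdiag _).1 (hdiag _).2]
  refine ⟨c default, fun y => eq_of_forall_shift_eq c hshift y default, ?_⟩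
  rw [Matrix.eta_fin_two (c default), (hdiag default).1, (hdiag default).2]
  exact commute_diag_σ₃ _ _

/-! ## §3 The `e₀`-toron of angle `a` on the abelian stratum, and the refutation of the `A′`-supplier -/

/-- The toron's `N`-th power read on the matrices: `diag(e^{iNa}, e^{−iNa})`. [folklore] -/
theorem coe_expPoint_e0_pow (a : ℝ) (N : ℕ) :
    (((expPoint (a • EuclideanSpace.single (0 : Fin 3) (1 : ℝ))) ^ N : SU2) : Matrix (Fin 2) (Fin 2) ℂ) =
      !![(⟨Real.cos ((N : ℝ) * a), Real.sin ((N : ℝ) * a)⟩ : ℂ), 0; 0, ⟨Real.cos ((N : ℝ) * a), -Real.sin ((N : ℝ) * a)⟩] := by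
  rw [expPoint_smul_pow, coe_expPoint_e0]

/-- ★★ **THE FLAT TORON LIES ON THE ABELIAN STRATUM**: for `sin(N·a) ≠ 0` (`N = sitesPerDir` of the datum lattice) the `e₀`-toron of angle `a` in direction `0` satisfies the `A′`
guard of ✓`uniformFibreGapOrbit_of_gaugedLetters` (`hD₂`∕`hF₂`) VERBATIM, with the trivial gauge. [folklore] -/
theorem toron_mem_abelianStratum (F : T3Family) (J : ℕ) {a : ℝ} (hsin : Real.sin ((((F.P J).sitesPerDir 0 : ℕ) : ℝ) * a) ≠ 0) :
    ∃ g : GaugeTransf (F.P J) 0 (Matrix.specialUnitaryGroup (Fin 2) ℂ),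
      (∀ e : PBond (F.P J) 0, Commute (((GaugeField.gaugeAct g
        (fun b : PBond (F.P J) 0 => if b.dir = ⟨0, (F.P J).hd⟩ then expPoint (a • EuclideanSpace.single (0 : Fin 3) (1 : ℝ)) else 1)) e :
          Matrix.specialUnitaryGroup (Fin 2) ℂ) : Matrix (Fin 2) (Fin 2) ℂ) σ₃) ∧
      ∀ c : Site (F.P J) 0 → Matrix (Fin 2) (Fin 2) ℂ,
        (∀ e : PBond (F.P J) 0, c e.src = ((unitsField (toUField (GaugeField.gaugeAct g
          (fun b : PBond (F.P J) 0 => if b.dir = ⟨0, (F.P J).hd⟩ then expPoint (a • EuclideanSpace.single (0 : Fin 3) (1 : ℝ)) else 1))) e :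
            (Matrix (Fin 2) (Fin 2) ℂ)ˣ) : Matrix (Fin 2) (Fin 2) ℂ) * c e.tgt *
          (((unitsField (toUField (GaugeField.gaugeAct g
            (fun b : PBond (F.P J) 0 => if b.dir = ⟨0, (F.P J).hd⟩ then expPoint (a • EuclideanSpace.single (0 : Fin 3) (1 : ℝ)) else 1))) e)⁻¹ :
              (Matrix (Fin 2) (Fin 2) ℂ)ˣ) : Matrix (Fin 2) (Fin 2) ℂ)) →
        ∃ c₀ : Matrix (Fin 2) (Fin 2) ℂ, (∀ y, c y = c₀) ∧ Commute c₀ σ₃ := by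
  refine ⟨fun _ => 1, ?_, ?_⟩
  · intro e
    rw [gaugeAct_one']
    exact commute_toron_bond_σ₃ a _ e
  · intro c hc
    rw [gaugeAct_one'] at hc
    have hzw : (⟨Real.cos ((((F.P J).sitesPerDir 0 : ℕ) : ℝ) * a), Real.sin ((((F.P J).sitesPerDir 0 : ℕ) : ℝ) * a)⟩ : ℂ) ≠
        ⟨Real.cos ((((F.P J).sitesPerDir 0 : ℕ) : ℝ) * a), -Real.sin ((((F.P J).sitesPerDir 0 : ℕ) : ℝ) * a)⟩ := by
      intro h
      have him : Real.sin ((((F.P J).sitesPerDir 0 : ℕ) : ℝ) * a) = -Real.sin ((((F.P J).sitesPerDir 0 : ℕ) : ℝ) * a) := congrArg Complex.im h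
      exact hsin (by linarith)
    have hone : (((1 : SU2)) : Matrix (Fin 2) (Fin 2) ℂ) = !![(1 : ℂ), 0; 0, 1] := by
      rw [OneMemClass.coe_one]; ext i j; fin_cases i <;> fin_cases j <;> rfl
    refine covConst_dirField_const (P := F.P J) (j := 0)
      (fun μ => if μ = ⟨0, (F.P J).hd⟩ then expPoint (a • EuclideanSpace.single (0 : Fin 3) (1 : ℝ)) else 1)
      (fun μ => if μ = ⟨0, (F.P J).hd⟩ then (⟨Real.cos a, Real.sin a⟩ : ℂ) else 1)
      (fun μ => if μ = ⟨0, (F.P J).hd⟩ then (⟨Real.cos a, -Real.sin a⟩ : ℂ) else 1)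
      (fun μ => ?_) ⟨0, (F.P J).hd⟩ (zN := ⟨Real.cos ((((F.P J).sitesPerDir 0 : ℕ) : ℝ) * a), Real.sin ((((F.P J).sitesPerDir 0 : ℕ) : ℝ) * a)⟩)
      (wN := ⟨Real.cos ((((F.P J).sitesPerDir 0 : ℕ) : ℝ) * a), -Real.sin ((((F.P J).sitesPerDir 0 : ℕ) : ℝ) * a)⟩)
      (by rw [if_pos rfl]; exact coe_expPoint_e0_pow a _) hzw c hc
    by_cases hμ : μ = ⟨0, (F.P J).hd⟩
    · rw [if_pos hμ, if_pos hμ, if_pos hμ]; exact coe_expPoint_e0 a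
    · rw [if_neg hμ, if_neg hμ, if_neg hμ]; exact hone

/-- ★★★ **THE `A′`-STRATUM SMALL-BOND SUPPLIER IS FALSE** (✓p824968's `hsupp` with `G := ` the `A′` guard of ✓p821904 VERBATIM and `G′ := G ∧ «∀ e, arc(V e) ≤ M»`): at block size `L`
(odd, `> 1`), for every angle `0 < a` with `2L·a ≤ π`, `sin(2L·a) ≠ 0` and every `M < a`.  `L = 5`, `a = π∕12`: every `M < 0.2617…`, in particular the `M ≤ 1∕4` of
✓`exists_gamma_chartLetter`. [folklore] -/
theorem not_hsupp_abelianStratum (L : ℕ) (hL : Odd L ∧ 1 < L) {a M : ℝ} (ha : 0 < a) (ha2L : ((2 * L : ℕ) : ℝ) * a ≤ π)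
    (hsin : Real.sin (((2 * L : ℕ) : ℝ) * a) ≠ 0) (hM : M < a) :
    ¬ (∀ (L : ℕ), ∃ c₀ : ℝ, 0 < c₀ ∧ c₀ ≤ 1 ∧ ∀ (cw : ℝ), 0 < cw → cw ≤ c₀ → ∃ pS : ℝ, ∀ (b₀ p₀ : ℝ), 0 < b₀ → pS ≤ p₀ → 0 < p₀ →
      ∃ γ₁ : ℝ, 0 < γ₁ ∧ ∀ (F : T3Family) (γ : ℝ), F.L = L → 0 < γ → γ ≤ γ₁ →
        ∀ (J : ℕ) (V : GaugeField (F.P J) 0 (Matrix.specialUnitaryGroup (Fin 2) ℂ)), PlaqSmall (θBal F.L γ (cw * b₀) p₀ J) V →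
          (∃ g : GaugeTransf (F.P J) 0 (Matrix.specialUnitaryGroup (Fin 2) ℂ),
            (∀ e : PBond (F.P J) 0, Commute (((GaugeField.gaugeAct g V) e : Matrix.specialUnitaryGroup (Fin 2) ℂ) : Matrix (Fin 2) (Fin 2) ℂ) σ₃) ∧
            ∀ c : Site (F.P J) 0 → Matrix (Fin 2) (Fin 2) ℂ,
              (∀ e : PBond (F.P J) 0, c e.src = ((unitsField (toUField (GaugeField.gaugeAct g V)) e : (Matrix (Fin 2) (Fin 2) ℂ)ˣ) : Matrix (Fin 2) (Fin 2) ℂ) * c e.tgt *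
              (((unitsField (toUField (GaugeField.gaugeAct g V)) e)⁻¹ : (Matrix (Fin 2) (Fin 2) ℂ)ˣ) : Matrix (Fin 2) (Fin 2) ℂ)) →
              ∃ c₀ : Matrix (Fin 2) (Fin 2) ℂ, (∀ y, c y = c₀) ∧ Commute c₀ σ₃) →
          ∃ u : GaugeTransf (F.P J) 0 (Matrix.specialUnitaryGroup (Fin 2) ℂ),
            ((∃ g : GaugeTransf (F.P J) 0 (Matrix.specialUnitaryGroup (Fin 2) ℂ),
              (∀ e : PBond (F.P J) 0, Commute (((GaugeField.gaugeAct g (GaugeField.gaugeAct u V)) e : Matrix.specialUnitaryGroup (Fin 2) ℂ) :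
                Matrix (Fin 2) (Fin 2) ℂ) σ₃) ∧
              ∀ c : Site (F.P J) 0 → Matrix (Fin 2) (Fin 2) ℂ,
                (∀ e : PBond (F.P J) 0, c e.src = ((unitsField (toUField (GaugeField.gaugeAct g (GaugeField.gaugeAct u V))) e : (Matrix (Fin 2) (Fin 2) ℂ)ˣ) :
                  Matrix (Fin 2) (Fin 2) ℂ) * c e.tgt *
                  (((unitsField (toUField (GaugeField.gaugeAct g (GaugeField.gaugeAct u V))) e)⁻¹ : (Matrix (Fin 2) (Fin 2) ℂ)ˣ) : Matrix (Fin 2) (Fin 2) ℂ)) →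
                ∃ c₀ : Matrix (Fin 2) (Fin 2) ℂ, (∀ y, c y = c₀) ∧ Commute c₀ σ₃) ∧
            ∀ e : PBond (F.P J) 0, ‖logVec (su2Quat (GaugeField.gaugeAct u V e))‖ ≤ M)) := by
  refine not_hsupp_smallBond_of_mem
    (fun (F : T3Family) (J : ℕ) (V : GaugeField (F.P J) 0 (Matrix.specialUnitaryGroup (Fin 2) ℂ)) =>
      ∃ g : GaugeTransf (F.P J) 0 (Matrix.specialUnitaryGroup (Fin 2) ℂ),
        (∀ e : PBond (F.P J) 0, Commute (((GaugeField.gaugeAct g V) e : Matrix.specialUnitaryGroup (Fin 2) ℂ) : Matrix (Fin 2) (Fin 2) ℂ) σ₃) ∧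
        ∀ c : Site (F.P J) 0 → Matrix (Fin 2) (Fin 2) ℂ,
          (∀ e : PBond (F.P J) 0, c e.src = ((unitsField (toUField (GaugeField.gaugeAct g V)) e : (Matrix (Fin 2) (Fin 2) ℂ)ˣ) : Matrix (Fin 2) (Fin 2) ℂ) * c e.tgt *
            (((unitsField (toUField (GaugeField.gaugeAct g V)) e)⁻¹ : (Matrix (Fin 2) (Fin 2) ℂ)ˣ) : Matrix (Fin 2) (Fin 2) ℂ)) →
          ∃ c₀ : Matrix (Fin 2) (Fin 2) ℂ, (∀ y, c y = c₀) ∧ Commute c₀ σ₃)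
    (fun (F : T3Family) (J : ℕ) (V : GaugeField (F.P J) 0 (Matrix.specialUnitaryGroup (Fin 2) ℂ)) =>
      (∃ g : GaugeTransf (F.P J) 0 (Matrix.specialUnitaryGroup (Fin 2) ℂ),
        (∀ e : PBond (F.P J) 0, Commute (((GaugeField.gaugeAct g V) e : Matrix.specialUnitaryGroup (Fin 2) ℂ) : Matrix (Fin 2) (Fin 2) ℂ) σ₃) ∧
        ∀ c : Site (F.P J) 0 → Matrix (Fin 2) (Fin 2) ℂ,
          (∀ e : PBond (F.P J) 0, c e.src = ((unitsField (toUField (GaugeField.gaugeAct g V)) e : (Matrix (Fin 2) (Fin 2) ℂ)ˣ) : Matrix (Fin 2) (Fin 2) ℂ) * c e.tgt *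
            (((unitsField (toUField (GaugeField.gaugeAct g V)) e)⁻¹ : (Matrix (Fin 2) (Fin 2) ℂ)ˣ) : Matrix (Fin 2) (Fin 2) ℂ)) →
          ∃ c₀ : Matrix (Fin 2) (Fin 2) ℂ, (∀ y, c y = c₀) ∧ Commute c₀ σ₃) ∧
      ∀ e : PBond (F.P J) 0, ‖logVec (su2Quat (V e))‖ ≤ M)
    L hL ha ha2L hM ?_ ?_
  · intro F hFL hFm
    have hN : (((F.P 0).sitesPerDir 0 : ℕ) : ℝ) = ((2 * L : ℕ) : ℝ) := by
      rw [sitesPerDir_run_zero, hFL, hFm, pow_one]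
    exact toron_mem_abelianStratum F 0 (by rw [hN]; exact hsin)
  · intro F J W hW
    exact hW.2

/-- ★★★ **AT THE CELL's BLOCK SIZE `L = 5`**: the `A′`-stratum small-bond supplier is false for EVERY `M < π∕12` — so for the `M ≤ 1∕4` of the (L♭) letter (`1∕4 < π∕12`).
[folklore] -/
theorem not_hsupp_abelianStratum_five {M : ℝ} (hM : M ≤ 1 / 4) :
    ¬ (∀ (L : ℕ), ∃ c₀ : ℝ, 0 < c₀ ∧ c₀ ≤ 1 ∧ ∀ (cw : ℝ), 0 < cw → cw ≤ c₀ → ∃ pS : ℝ, ∀ (b₀ p₀ : ℝ), 0 < b₀ → pS ≤ p₀ → 0 < p₀ →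
      ∃ γ₁ : ℝ, 0 < γ₁ ∧ ∀ (F : T3Family) (γ : ℝ), F.L = L → 0 < γ → γ ≤ γ₁ →
        ∀ (J : ℕ) (V : GaugeField (F.P J) 0 (Matrix.specialUnitaryGroup (Fin 2) ℂ)), PlaqSmall (θBal F.L γ (cw * b₀) p₀ J) V →
          (∃ g : GaugeTransf (F.P J) 0 (Matrix.specialUnitaryGroup (Fin 2) ℂ),
            (∀ e : PBond (F.P J) 0, Commute (((GaugeField.gaugeAct g V) e : Matrix.specialUnitaryGroup (Fin 2) ℂ) : Matrix (Fin 2) (Fin 2) ℂ) σ₃) ∧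
            ∀ c : Site (F.P J) 0 → Matrix (Fin 2) (Fin 2) ℂ,
              (∀ e : PBond (F.P J) 0, c e.src = ((unitsField (toUField (GaugeField.gaugeAct g V)) e : (Matrix (Fin 2) (Fin 2) ℂ)ˣ) : Matrix (Fin 2) (Fin 2) ℂ) * c e.tgt *
              (((unitsField (toUField (GaugeField.gaugeAct g V)) e)⁻¹ : (Matrix (Fin 2) (Fin 2) ℂ)ˣ) : Matrix (Fin 2) (Fin 2) ℂ)) →
              ∃ c₀ : Matrix (Fin 2) (Fin 2) ℂ, (∀ y, c y = c₀) ∧ Commute c₀ σ₃) →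
          ∃ u : GaugeTransf (F.P J) 0 (Matrix.specialUnitaryGroup (Fin 2) ℂ),
            ((∃ g : GaugeTransf (F.P J) 0 (Matrix.specialUnitaryGroup (Fin 2) ℂ),
              (∀ e : PBond (F.P J) 0, Commute (((GaugeField.gaugeAct g (GaugeField.gaugeAct u V)) e : Matrix.specialUnitaryGroup (Fin 2) ℂ) :
                Matrix (Fin 2) (Fin 2) ℂ) σ₃) ∧
              ∀ c : Site (F.P J) 0 → Matrix (Fin 2) (Fin 2) ℂ,
                (∀ e : PBond (F.P J) 0, c e.src = ((unitsField (toUField (GaugeField.gaugeAct g (GaugeField.gaugeAct u V))) e : (Matrix (Fin 2) (Fin 2) ℂ)ˣ) :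
                  Matrix (Fin 2) (Fin 2) ℂ) * c e.tgt *
                  (((unitsField (toUField (GaugeField.gaugeAct g (GaugeField.gaugeAct u V))) e)⁻¹ : (Matrix (Fin 2) (Fin 2) ℂ)ˣ) : Matrix (Fin 2) (Fin 2) ℂ)) →
                ∃ c₀ : Matrix (Fin 2) (Fin 2) ℂ, (∀ y, c y = c₀) ∧ Commute c₀ σ₃) ∧
            ∀ e : PBond (F.P J) 0, ‖logVec (su2Quat (GaugeField.gaugeAct u V e))‖ ≤ M)) := by
  have hπ := Real.pi_gt_three
  have h10 : ((2 * 5 : ℕ) : ℝ) * (π / 12) = 5 * π / 6 := by push_cast; ring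
  refine not_hsupp_abelianStratum 5 ⟨by decide, by decide⟩ (a := π / 12) (by positivity) (by rw [h10]; linarith) ?_ (by linarith)
  rw [h10, show 5 * π / 6 = π - π / 6 by ring, Real.sin_pi_sub, Real.sin_pi_div_six]
  norm_num

end Summit.QuantumFields.YangMills.Theorems.FluctuationComparisonRegPrIntLS2BetaSmallBondGaugeToronAbelianStratum

end
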